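import Literature.Analysis.FluidPDE.TaoClassTranslation
import Literature.Analysis.FluidPDE.AxisymmetricNoSwirlGlobal
import Summits.NavierStokesRegularity.NavierStokesRegularity.Theorems.HeredityAtOneT.Negative.DeadSliceBackwardStage
import HarnessLib

/-!
# Dead slices propagate backwards in Tao's class, for every viscosity (Negative lane, `HeredityAtOneT`)

`Theorems/HeredityAtOneT/Negative/DeadSliceBackwardStage.lean` proved: for a CLASSICAL run
with `ν = 1`, zero force, finite energy and a rapidly decaying datum, a dead (placed axisymmetric
swirl-free, `PalasekTowerLiveClassAt.DeadSlice`) final slice forces a dead datum — by embedding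
the placed run into Tao's class. With the rigid-placement invariance of Tao's class
(`Literature.IsTaoSolutionOn.rigidPlacement`) the same conclusion holds DIRECTLY for every
Tao-class run `IsTaoSolutionOn T ν u₀ u p` and EVERY viscosity `ν > 0`, with no decay or
energy hypotheses beyond the class: if `u t₁` is a dead slice for some `t₁ ∈ (0, T]`, then so is
`u₀` (`deadSlice_initial_of_deadSlice_at`); contrapositively a live datum stays live at every
time of the slab (`not_deadSlice_of_not_deadSlice_initial`), and the live class is constant in
time (`deadSlice_iff_initial`, forward half = `IsTaoSolutionOn.isAxisymmetric` / `.hasNoSwirl` of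
`AxisymmetricNoSwirlGlobal`). Ingredients: equivariance propagation
(`TaoClassSymmetry.conj_eq_of_datum`) run backwards through backward uniqueness in
Tao's class (`DeadSliceBackwardStage.isAxisymmetric_hasNoSwirl_initial_of_final`; Temam 1997,
Ch. III §6.2, Lemma 6.2) and restriction of the class to `[0, t₁]` (`IsTaoSolutionOn.mono`).

bears_on: stmt-NavierStokesRegularity-20304 `HeredityAtOneT` / 20305 / 20303 (LADDER-NS N1) —
the live-class bookkeeping of the tower (germ runs, host runs and stages are Tao-class or
embed into it): membership in the dead class is decided by the datum alone, at any viscosity.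
WHAT THIS IS NOT: not Navier–Stokes evidence; [folklore] symmetry + backward uniqueness;
sorry-free, std axioms.
-/

noncomputable section

open Set
open Literature.Analysis.FluidPDE
open Summit.NavierStokesRegularity.FluidComputer.PalasekTowerClayBridge

namespace Summit.NavierStokesRegularity.HeredityAtOneTDeadSliceBackwardTaoClass

variable {T ν : ℝ} {u₀ : EuclideanSpace ℝ (Fin 3) → EuclideanSpace ℝ (Fin 3)}
  {u : ℝ → EuclideanSpace ℝ (Fin 3) → EuclideanSpace ℝ (Fin 3)}
  {p : ℝ → EuclideanSpace ℝ (Fin 3) → ℝ}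

/-- A rigid placement of a Tao-class run is a Tao-class run from the placed datum, in the
`conjSlice` notation of `PalasekTowerLiveClassAt`. [folklore] -/
theorem isTaoSolutionOn_conjSlice (hT : 0 < T) (h : IsTaoSolutionOn T ν u₀ u p)
    (A : EuclideanSpace ℝ (Fin 3) ≃ₗᵢ[ℝ] EuclideanSpace ℝ (Fin 3)) (b : EuclideanSpace ℝ (Fin 3)) :
    IsTaoSolutionOn T ν (conjSlice A b u₀) (fun t => conjSlice A b (u t))
      (fun t x => p t (A x + b)) :=
  h.rigidPlacement hT A b

/-- **Dead final slice ⇒ dead datum, Tao class, any `ν > 0`.** [cite: Temam1997, Ch. III §6.2 Lemma 6.2 (pp. 172-175)] -/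
theorem deadSlice_initial_of_deadSlice_final (hT : 0 < T) (hν : 0 < ν)
    (h : IsTaoSolutionOn T ν u₀ u p) (hdead : DeadSlice (u T)) : DeadSlice u₀ := by
  obtain ⟨A, b, hax, hsw⟩ := hdead
  exact ⟨A, b, HeredityAtOneTDeadSliceBackwardStage.isAxisymmetric_hasNoSwirl_initial_of_final
    hT hν (isTaoSolutionOn_conjSlice hT h A b) hax hsw⟩

/-- **Dead slice at any time `t₁ ∈ (0, T]` ⇒ dead datum** (restrict the class to `[0, t₁]`).
[cite: Temam1997, Ch. III §6.2 Lemma 6.2 (pp. 172-175)] -/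
theorem deadSlice_initial_of_deadSlice_at (hν : 0 < ν) (h : IsTaoSolutionOn T ν u₀ u p)
    {t₁ : ℝ} (ht₁ : t₁ ∈ Ioc 0 T) (hdead : DeadSlice (u t₁)) : DeadSlice u₀ :=
  deadSlice_initial_of_deadSlice_final ht₁.1 hν (h.mono ht₁.1 ht₁.2) hdead

/-- **A live datum stays live on the whole slab**, Tao class, any `ν > 0`. [folklore] -/
theorem not_deadSlice_of_not_deadSlice_initial (hν : 0 < ν) (h : IsTaoSolutionOn T ν u₀ u p)
    (hlive : ¬ DeadSlice u₀) {t₁ : ℝ} (ht₁ : t₁ ∈ Ioc 0 T) : ¬ DeadSlice (u t₁) :=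
  fun hd => hlive (deadSlice_initial_of_deadSlice_at hν h ht₁ hd)

/-- The datum itself: `u 0 = u₀` is dead iff `u₀` is, so the live class is constant in time on
`[0, T]`: `DeadSlice (u t) ↔ DeadSlice u₀` for every `t ∈ [0, T]`. [folklore] -/
theorem deadSlice_iff_initial (hν : 0 < ν) (h : IsTaoSolutionOn T ν u₀ u p) {t₁ : ℝ}
    (ht₁ : t₁ ∈ Icc 0 T) : DeadSlice (u t₁) ↔ DeadSlice u₀ := by
  rcases eq_or_lt_of_le ht₁.1 with h0 | h0
  · rw [← h0, h.initial]
  · refine ⟨deadSlice_initial_of_deadSlice_at hν h ⟨h0, ht₁.2⟩, fun hd => ?_⟩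
    -- forward: equivariance propagates forward (`conj_eq_of_datum`) for the placed run
    obtain ⟨A, b, hax, hsw⟩ := hd
    have hv := isTaoSolutionOn_conjSlice (h0.trans_le ht₁.2) h A b
    exact ⟨A, b, hv.isAxisymmetric hν (h0.trans_le ht₁.2) hax t₁ ht₁,
      hv.hasNoSwirl hν (h0.trans_le ht₁.2) hax hsw t₁ ht₁⟩

end Summit.NavierStokesRegularity.HeredityAtOneTDeadSliceBackwardTaoClass

end
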